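import Literature.Analysis.SegalBargmann.HermiteMultiplierStrongContinuity
import HarnessLib

/-!
# Degree-block operators on the Schwartz space and their strong continuity

The Hermite multipliers `T_m` of `HermiteMultiplierOperators` are the operators DIAGONAL in the Hermite basis
`h_β` of `𝒮(ℝ^σ, ℂ)`.  This file treats the next class: operators which are BLOCK-DIAGONAL with respect to the
degree grading `𝒮 ⊋ ⊕_d V_d`, `V_d = span {h_β : |β| = d}` (the eigenspaces of the number operator), given by a
kernel `u(α, β)` with `u(α, β) = 0` unless `|α| = |β|` and entries of polynomial growth `‖u(α,β)‖ ≤ M (|β|+1)^a`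
(`IsBlockKernel u a M`):

  `T_u f := Σ_α w_α(f) h_α`,  `w_α(f) := Σ_{|β| ≤ |α|} u(α,β) c_β(f)`  (`blockCoeff`; only `|β| = |α|` contributes).

* §1 the coefficient estimates: `(|α|+1)^μ ‖w_α(f)‖ ≤ M · Q_ν(f) · (|α|+1)^{−(n+2)}` with `Q_ν(f) = Σ_γ (|γ|+1)^ν ‖c_γ(f)‖`
  (`coeffMass`), `ν = μ + a + n + (n+2)`, `n = |σ|` — so the weights are summable against every power of the
  degree and controlled by finitely many Schwartz seminorms;
* §2 `hermiteBlockCLM u hu : 𝒮 →L[ℂ] 𝒮` with `c_α(T_u f) = w_α(f)`, the uniform (equicontinuity) bound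
  `exists_seminorm_hermiteBlockCLM_le_sup_seminorm`, the action on the basis and the consistency with the diagonal
  case (`hermiteBlockCLM_diagonal`);
* §3 strong continuity: if `u_i(α,β) → u₀(α,β)` entrywise along a filter with a uniform block bound then
  `T_{u_i} f → T_{u₀} f` in `𝒮` for every `f` (`tendsto_hermiteBlockCLM_apply`, Tannery's theorem on the weights),
  `continuous_hermiteBlockCLM_apply`, and the JOINT continuity `continuous_hermiteBlockCLM_uncurry`.

This is the vehicle through which a compact group acting degree-preservingly and boundedly on the polynomial
Fock spaces (e.g. `U(σ)` by substitution) acts strongly continuously on the whole Schwartz space.  Everything is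
proved from the Hermite expansion files; no cited fact is used as a hypothesis (Folland 1989 §1.7 is the source of
the basis and its grading).
-/

noncomputable section

open Complex SchwartzMap MeasureTheory Filter Topology
open scoped BigOperators Real NNReal

namespace Literature.Analysis.SegalBargmann

variable {σ : Type*} [Fintype σ] [DecidableEq σ]

/-! ## §1  Block kernels and the coefficient estimates -/

section Kernel

/-- **A degree-block kernel of polynomial growth**: `u(α,β) = 0` unless `|α| = |β|`, and
`‖u(α,β)‖ ≤ M (|β|+1)^a`. [folklore] -/
structure IsBlockKernel (u : (σ →₀ ℕ) → (σ →₀ ℕ) → ℂ) (a : ℕ) (M : ℝ) : Prop where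
  eq_zero : ∀ α β, α.degree ≠ β.degree → u α β = 0
  norm_le : ∀ α β, ‖u α β‖ ≤ M * ((β.degree : ℝ) + 1) ^ a

variable {u u' : (σ →₀ ℕ) → (σ →₀ ℕ) → ℂ} {a : ℕ} {M M' : ℝ}

omit [Fintype σ] [DecidableEq σ] in
/-- The growth constant of a block kernel is non-negative. [folklore] -/
theorem IsBlockKernel.nonneg (hu : IsBlockKernel u a M) : 0 ≤ M := by
  have h := hu.norm_le 0 0
  simp only [map_zero, Nat.cast_zero, zero_add, one_pow, mul_one] at h
  exact (norm_nonneg _).trans h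

omit [Fintype σ] [DecidableEq σ] in
/-- The difference of two block kernels with the same exponent is a block kernel with constant `M + M′`. [folklore] -/
theorem IsBlockKernel.sub (hu : IsBlockKernel u a M) (hu' : IsBlockKernel u' a M') :
    IsBlockKernel (u - u') a (M + M') where
  eq_zero α β h := by rw [Pi.sub_apply, Pi.sub_apply, hu.eq_zero α β h, hu'.eq_zero α β h, sub_zero]
  norm_le α β := by
    rw [Pi.sub_apply, Pi.sub_apply, add_mul]
    exact (norm_sub_le _ _).trans (add_le_add (hu.norm_le α β) (hu'.norm_le α β))

omit [Fintype σ] [DecidableEq σ] in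
/-- A block kernel with constant `M ≤ M′` is a block kernel with constant `M′`. [folklore] -/
theorem IsBlockKernel.mono (hu : IsBlockKernel u a M) (h : M ≤ M') : IsBlockKernel u a M' where
  eq_zero := hu.eq_zero
  norm_le α β := (hu.norm_le α β).trans (mul_le_mul_of_nonneg_right h (by positivity))

/-- **The weighted coefficient mass** `Q_ν(f) := Σ_γ (|γ|+1)^ν ‖c_γ(f)‖` (finite for Schwartz `f`,
`summable_degree_pow_mul_norm_hermiteCoeff`). [folklore] -/
def coeffMass (ν : ℕ) (f : 𝓢(EuclideanSpace ℝ σ, ℂ)) : ℝ :=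
  ∑' γ : σ →₀ ℕ, ((γ.degree : ℝ) + 1) ^ ν * ‖hermiteCoeff γ f‖

/-- `0 ≤ Q_ν(f)`. [folklore] -/
theorem coeffMass_nonneg (ν : ℕ) (f : 𝓢(EuclideanSpace ℝ σ, ℂ)) : 0 ≤ coeffMass ν f :=
  tsum_nonneg fun γ => by positivity

/-- A single term is bounded by the mass: `(|γ|+1)^ν ‖c_γ(f)‖ ≤ Q_ν(f)`. [folklore] -/
theorem degree_pow_mul_norm_hermiteCoeff_le_coeffMass (ν : ℕ) (f : 𝓢(EuclideanSpace ℝ σ, ℂ)) (γ : σ →₀ ℕ) :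
    ((γ.degree : ℝ) + 1) ^ ν * ‖hermiteCoeff γ f‖ ≤ coeffMass ν f :=
  (summable_degree_pow_mul_norm_hermiteCoeff ν f).le_tsum γ fun β _ => by positivity

/-- `‖c_γ(f)‖ ≤ (|γ|+1)^{−ν} Q_ν(f)`. [folklore] -/
theorem norm_hermiteCoeff_le_coeffMass (ν : ℕ) (f : 𝓢(EuclideanSpace ℝ σ, ℂ)) (γ : σ →₀ ℕ) :
    ‖hermiteCoeff γ f‖ ≤ (((γ.degree : ℝ) + 1) ^ ν)⁻¹ * coeffMass ν f := by
  have hpos : 0 < ((γ.degree : ℝ) + 1) ^ ν := by positivity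
  rw [le_inv_mul_iff₀ hpos]
  exact degree_pow_mul_norm_hermiteCoeff_le_coeffMass ν f γ

/-- **The mass is controlled by finitely many Schwartz seminorms**: `Q_ν(f) ≤ C · (s.sup p)(f)`. [folklore] -/
theorem exists_coeffMass_le_sup_seminorm (ν : ℕ) :
    ∃ (s : Finset (ℕ × ℕ)) (C : ℝ), 0 ≤ C ∧ ∀ f : 𝓢(EuclideanSpace ℝ σ, ℂ),
      coeffMass ν f ≤ C * (s.sup (schwartzSeminormFamily ℂ (EuclideanSpace ℝ σ) ℂ)) f :=
  exists_tsum_degree_pow_mul_norm_hermiteCoeff_le_sup_seminorm ν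

/-- The mass is additive-subadditive: `Q_ν(f + g) ≤ Q_ν(f) + Q_ν(g)`. [folklore] -/
theorem coeffMass_add_le (ν : ℕ) (f g : 𝓢(EuclideanSpace ℝ σ, ℂ)) :
    coeffMass ν (f + g) ≤ coeffMass ν f + coeffMass ν g := by
  rw [coeffMass, coeffMass, coeffMass, ← (summable_degree_pow_mul_norm_hermiteCoeff ν f).tsum_add
    (summable_degree_pow_mul_norm_hermiteCoeff ν g)]
  refine (summable_degree_pow_mul_norm_hermiteCoeff ν (f + g)).tsum_le_tsum (fun γ => ?_)
    ((summable_degree_pow_mul_norm_hermiteCoeff ν f).add (summable_degree_pow_mul_norm_hermiteCoeff ν g))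
  rw [← mul_add, hermiteCoeff_add]
  exact mul_le_mul_of_nonneg_left (norm_add_le _ _) (by positivity)

variable (u)

/-- **The block coefficient** `w_α(f) := Σ_{|β| ≤ |α|} u(α,β) c_β(f)` (for a block kernel only `|β| = |α|`
contributes). [folklore] -/
def blockCoeff (f : 𝓢(EuclideanSpace ℝ σ, ℂ)) (α : σ →₀ ℕ) : ℂ :=
  ∑ β ∈ degLE α.degree, u α β * hermiteCoeff β f

/-- `w_α(f + g) = w_α(f) + w_α(g)`. [folklore] -/
theorem blockCoeff_add (f g : 𝓢(EuclideanSpace ℝ σ, ℂ)) (α : σ →₀ ℕ) :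
    blockCoeff u (f + g) α = blockCoeff u f α + blockCoeff u g α := by
  simp only [blockCoeff, hermiteCoeff_add, mul_add, Finset.sum_add_distrib]

/-- `w_α(c f) = c w_α(f)`. [folklore] -/
theorem blockCoeff_smul (c : ℂ) (f : 𝓢(EuclideanSpace ℝ σ, ℂ)) (α : σ →₀ ℕ) :
    blockCoeff u (c • f) α = c * blockCoeff u f α := by
  simp only [blockCoeff, hermiteCoeff_smul, Finset.mul_sum]
  exact Finset.sum_congr rfl fun β _ => by ring

/-- The block coefficient is linear in the kernel: `w^{u−u′}_α = w^u_α − w^{u′}_α`. [folklore] -/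
theorem blockCoeff_sub_kernel (u' : (σ →₀ ℕ) → (σ →₀ ℕ) → ℂ) (f : 𝓢(EuclideanSpace ℝ σ, ℂ)) (α : σ →₀ ℕ) :
    blockCoeff (u - u') f α = blockCoeff u f α - blockCoeff u' f α := by
  simp only [blockCoeff, Pi.sub_apply, sub_mul, Finset.sum_sub_distrib]

variable {u}

/-- **The single-entry bound**: `‖u(α,β) c_β(f)‖ ≤ M (|α|+1)^a (|α|+1)^{−ν} Q_ν(f)` for every `β` (the entry
vanishes unless `|β| = |α|`). [folklore] -/
theorem norm_entry_mul_hermiteCoeff_le (hu : IsBlockKernel u a M) (ν : ℕ) (f : 𝓢(EuclideanSpace ℝ σ, ℂ))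
    (α β : σ →₀ ℕ) :
    ‖u α β * hermiteCoeff β f‖ ≤
      M * ((α.degree : ℝ) + 1) ^ a * ((((α.degree : ℝ) + 1) ^ ν)⁻¹ * coeffMass ν f) := by
  by_cases h : α.degree = β.degree
  · rw [norm_mul, h]
    exact mul_le_mul (hu.norm_le α β) (norm_hermiteCoeff_le_coeffMass ν f β) (norm_nonneg _)
      (mul_nonneg hu.nonneg (by positivity))
  · rw [hu.eq_zero α β h, zero_mul, norm_zero]
    exact mul_nonneg (mul_nonneg hu.nonneg (by positivity))
      (mul_nonneg (by positivity) (coeffMass_nonneg ν f))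

/-- **The block-coefficient bound**: `‖w_α(f)‖ ≤ M (|α|+1)^{a+n} (|α|+1)^{−ν} Q_ν(f)` (`n = |σ|`; the block has at
most `(|α|+1)^n` columns, `card_degLE_le`). [folklore] -/
theorem norm_blockCoeff_le (hu : IsBlockKernel u a M) (ν : ℕ) (f : 𝓢(EuclideanSpace ℝ σ, ℂ)) (α : σ →₀ ℕ) :
    ‖blockCoeff u f α‖ ≤
      M * ((α.degree : ℝ) + 1) ^ (a + Fintype.card σ) * ((((α.degree : ℝ) + 1) ^ ν)⁻¹ * coeffMass ν f) := by
  refine (norm_sum_le _ _).trans ?_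
  refine (Finset.sum_le_card_nsmul _ _ _ fun β _ => norm_entry_mul_hermiteCoeff_le hu ν f α β).trans ?_
  rw [nsmul_eq_mul]
  have hcard : ((degLE α.degree : Finset (σ →₀ ℕ)).card : ℝ) ≤ ((α.degree : ℝ) + 1) ^ Fintype.card σ := by
    exact_mod_cast card_degLE_le (σ := σ) α.degree
  have h0 : 0 ≤ M * ((α.degree : ℝ) + 1) ^ a * ((((α.degree : ℝ) + 1) ^ ν)⁻¹ * coeffMass ν f) :=
    mul_nonneg (mul_nonneg hu.nonneg (by positivity)) (mul_nonneg (by positivity) (coeffMass_nonneg ν f))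
  calc ((degLE α.degree : Finset (σ →₀ ℕ)).card : ℝ) *
        (M * ((α.degree : ℝ) + 1) ^ a * ((((α.degree : ℝ) + 1) ^ ν)⁻¹ * coeffMass ν f))
      ≤ ((α.degree : ℝ) + 1) ^ Fintype.card σ *
        (M * ((α.degree : ℝ) + 1) ^ a * ((((α.degree : ℝ) + 1) ^ ν)⁻¹ * coeffMass ν f)) :=
        mul_le_mul_of_nonneg_right hcard h0
    _ = M * ((α.degree : ℝ) + 1) ^ (a + Fintype.card σ) * ((((α.degree : ℝ) + 1) ^ ν)⁻¹ * coeffMass ν f) := by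
        rw [pow_add]; ring

/-- **The weighted block-coefficient bound**: with `ν = μ + a + n + (n+2)`,
`(|α|+1)^μ ‖w_α(f)‖ ≤ M Q_ν(f) (|α|+1)^{−(n+2)}`. [folklore] -/
theorem degree_pow_mul_norm_blockCoeff_le (hu : IsBlockKernel u a M) (μ : ℕ) (f : 𝓢(EuclideanSpace ℝ σ, ℂ))
    (α : σ →₀ ℕ) :
    ((α.degree : ℝ) + 1) ^ μ * ‖blockCoeff u f α‖ ≤
      M * coeffMass (μ + a + Fintype.card σ + (Fintype.card σ + 2)) f *
        (((α.degree : ℝ) + 1) ^ (Fintype.card σ + 2))⁻¹ := by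
  set n : ℕ := Fintype.card σ
  set D : ℝ := (α.degree : ℝ) + 1 with hD
  have hDpos : 0 < D := by positivity
  have h := mul_le_mul_of_nonneg_left (norm_blockCoeff_le hu (μ + a + n + (n + 2)) f α) (pow_nonneg hDpos.le μ)
  refine h.trans (le_of_eq ?_)
  rw [← hD]
  have hDk : ∀ k : ℕ, D ^ k ≠ 0 := fun k => pow_ne_zero k hDpos.ne'
  field_simp
  ring

/-- **Summability of the weighted block coefficients** against every power of the degree. [folklore] -/
theorem summable_degree_pow_mul_norm_blockCoeff (hu : IsBlockKernel u a M) (μ : ℕ)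
    (f : 𝓢(EuclideanSpace ℝ σ, ℂ)) :
    Summable fun α : σ →₀ ℕ => ((α.degree : ℝ) + 1) ^ μ * ‖blockCoeff u f α‖ :=
  ((summable_inv_degree_add_one_pow (σ := σ)).mul_left
    (M * coeffMass (μ + a + Fintype.card σ + (Fintype.card σ + 2)) f)).of_nonneg_of_le
    (fun α => by positivity) (degree_pow_mul_norm_blockCoeff_le hu μ f)

/-- **The weighted sum bound**: `Σ_α (|α|+1)^μ ‖w_α(f)‖ ≤ M Q_ν(f) W`, `W = Σ_α (|α|+1)^{−(n+2)}`. [folklore] -/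
theorem tsum_degree_pow_mul_norm_blockCoeff_le (hu : IsBlockKernel u a M) (μ : ℕ)
    (f : 𝓢(EuclideanSpace ℝ σ, ℂ)) :
    ∑' α : σ →₀ ℕ, ((α.degree : ℝ) + 1) ^ μ * ‖blockCoeff u f α‖ ≤
      M * coeffMass (μ + a + Fintype.card σ + (Fintype.card σ + 2)) f *
        ∑' α : σ →₀ ℕ, (((α.degree : ℝ) + 1) ^ (Fintype.card σ + 2))⁻¹ := by
  rw [← tsum_mul_left]
  exact (summable_degree_pow_mul_norm_blockCoeff hu μ f).tsum_le_tsum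
    (degree_pow_mul_norm_blockCoeff_le hu μ f)
    ((summable_inv_degree_add_one_pow (σ := σ)).mul_left _)

end Kernel

/-! ## §2  The block operator `T_u` -/

section Operator

variable {u u' : (σ →₀ ℕ) → (σ →₀ ℕ) → ℂ} {a : ℕ} {M M' : ℝ}

variable (u)

/-- **The block operator `T_u f = Σ_α w_α(f) h_α`** as a linear map on `𝒮(ℝ^σ, ℂ)` (the series converges in `𝒮`,
`summable_smul_hermiteSchwartz_herm`). [folklore] -/
def hermiteBlockₗ (hu : IsBlockKernel u a M) : 𝓢(EuclideanSpace ℝ σ, ℂ) →ₗ[ℂ] 𝓢(EuclideanSpace ℝ σ, ℂ) where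
  toFun f := ∑' α : σ →₀ ℕ, blockCoeff u f α • hermiteSchwartz (herm α)
  map_add' f g := by
    have hf := summable_smul_hermiteSchwartz_herm (summable_degree_pow_mul_norm_blockCoeff hu · f)
    have hg := summable_smul_hermiteSchwartz_herm (summable_degree_pow_mul_norm_blockCoeff hu · g)
    rw [← hf.tsum_add hg]
    congr 1
    funext α
    rw [blockCoeff_add, add_smul]
  map_smul' c f := by
    have hf := summable_smul_hermiteSchwartz_herm (summable_degree_pow_mul_norm_blockCoeff hu · f)
    rw [RingHom.id_apply, ← hf.tsum_const_smul c]
    congr 1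
    funext α
    rw [blockCoeff_smul, smul_smul]

/-- The defining series: `Σ_α w_α(f) h_α = T_u f` in `𝒮(ℝ^σ)`. [folklore] -/
theorem hasSum_hermiteBlockₗ (hu : IsBlockKernel u a M) (f : 𝓢(EuclideanSpace ℝ σ, ℂ)) :
    HasSum (fun α : σ →₀ ℕ => blockCoeff u f α • hermiteSchwartz (herm α)) (hermiteBlockₗ u hu f) :=
  (summable_smul_hermiteSchwartz_herm (summable_degree_pow_mul_norm_blockCoeff hu · f)).hasSum

/-- **`c_α(T_u f) = w_α(f)`.** [folklore] -/
theorem hermiteCoeff_hermiteBlockₗ (hu : IsBlockKernel u a M) (f : 𝓢(EuclideanSpace ℝ σ, ℂ)) (α : σ →₀ ℕ) :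
    hermiteCoeff α (hermiteBlockₗ u hu f) = blockCoeff u f α :=
  hermiteCoeff_of_hasSum (hasSum_hermiteBlockₗ u hu f) α

variable {u}

/-- **Uniform seminorm bounds for block operators** (equicontinuity of `{T_u : IsBlockKernel u a M}` for fixed
`a`): for every `(k,l)` there are finitely many Schwartz seminorms `s` and `C ≥ 0` with
`p_{k,l}(T_u f) ≤ M · C · (s.sup p)(f)` for ALL block kernels of exponent `a` and constant `M` and all `f`. [folklore] -/
theorem exists_seminorm_hermiteBlockₗ_le_sup_seminorm (k l a : ℕ) :
    ∃ (s : Finset (ℕ × ℕ)) (C : ℝ), 0 ≤ C ∧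
      ∀ (u : (σ →₀ ℕ) → (σ →₀ ℕ) → ℂ) (M : ℝ) (hu : IsBlockKernel u a M) (f : 𝓢(EuclideanSpace ℝ σ, ℂ)),
        SchwartzMap.seminorm ℂ k l (hermiteBlockₗ u hu f) ≤
          M * C * (s.sup (schwartzSeminormFamily ℂ (EuclideanSpace ℝ σ) ℂ)) f := by
  set n : ℕ := Fintype.card σ with hn
  obtain ⟨C, hC0, hC⟩ := exists_seminorm_hermiteSchwartz_herm_le (σ := σ) k l
  obtain ⟨s, C', hC'0, hC'⟩ :=
    exists_coeffMass_le_sup_seminorm (σ := σ) ((k + l + n + 1) + a + n + (n + 2))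
  set W : ℝ := ∑' α : σ →₀ ℕ, (((α.degree : ℝ) + 1) ^ (n + 2))⁻¹ with hWdef
  have hW0 : 0 ≤ W := tsum_nonneg fun α => by positivity
  refine ⟨s, C * W * C', by positivity, fun u M hu f => ?_⟩
  have hM := hu.nonneg
  have e1 := seminorm_le_of_hasSum hC0 hC (hasSum_hermiteBlockₗ u hu f)
    (summable_degree_pow_mul_norm_blockCoeff hu (k + l + Fintype.card σ + 1) f)
  have e2 := tsum_degree_pow_mul_norm_blockCoeff_le hu (k + l + Fintype.card σ + 1) f
  rw [← hn] at e1 e2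
  rw [← hWdef] at e2
  calc SchwartzMap.seminorm ℂ k l (hermiteBlockₗ u hu f)
      ≤ C * ∑' α : σ →₀ ℕ, ((α.degree : ℝ) + 1) ^ (k + l + n + 1) * ‖blockCoeff u f α‖ := e1
    _ ≤ C * (M * coeffMass ((k + l + n + 1) + a + n + (n + 2)) f * W) := by gcongr
    _ ≤ C * (M * (C' * (s.sup (schwartzSeminormFamily ℂ (EuclideanSpace ℝ σ) ℂ)) f) * W) := by
        gcongr
        exact hC' f
    _ = M * (C * W * C') * (s.sup (schwartzSeminormFamily ℂ (EuclideanSpace ℝ σ) ℂ)) f := by ring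

variable (u)

/-- **`T_u` is continuous on `𝒮(ℝ^σ, ℂ)`.** [folklore] -/
theorem continuous_hermiteBlockₗ (hu : IsBlockKernel u a M) : Continuous (hermiteBlockₗ u hu) := by
  have hW := schwartz_withSeminorms ℂ (EuclideanSpace ℝ σ) ℂ
  refine WithSeminorms.continuous_of_isBounded hW hW (hermiteBlockₗ u hu)
    (Seminorm.IsBounded.of_real fun i => ?_)
  obtain ⟨k, l⟩ := i
  obtain ⟨s, C, hC0, h⟩ := exists_seminorm_hermiteBlockₗ_le_sup_seminorm (σ := σ) k l a
  exact ⟨s, M * C, fun f => h u M hu f⟩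

/-- **The block operator `T_u : 𝒮(ℝ^σ, ℂ) →L[ℂ] 𝒮(ℝ^σ, ℂ)`** of a degree-block kernel of polynomial growth.
[folklore] -/
def hermiteBlockCLM (hu : IsBlockKernel u a M) : 𝓢(EuclideanSpace ℝ σ, ℂ) →L[ℂ] 𝓢(EuclideanSpace ℝ σ, ℂ) :=
  ⟨hermiteBlockₗ u hu, continuous_hermiteBlockₗ u hu⟩

/-- Unfolding. [folklore] -/
theorem hermiteBlockCLM_apply (hu : IsBlockKernel u a M) (f : 𝓢(EuclideanSpace ℝ σ, ℂ)) :
    hermiteBlockCLM u hu f = ∑' α : σ →₀ ℕ, blockCoeff u f α • hermiteSchwartz (herm α) := rfl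

/-- `Σ_α w_α(f) h_α = T_u f` in `𝒮(ℝ^σ)`. [folklore] -/
theorem hasSum_hermiteBlockCLM (hu : IsBlockKernel u a M) (f : 𝓢(EuclideanSpace ℝ σ, ℂ)) :
    HasSum (fun α : σ →₀ ℕ => blockCoeff u f α • hermiteSchwartz (herm α)) (hermiteBlockCLM u hu f) :=
  hasSum_hermiteBlockₗ u hu f

/-- **`c_α(T_u f) = w_α(f) = Σ_{|β|=|α|} u(α,β) c_β(f)`.** [folklore] -/
theorem hermiteCoeff_hermiteBlockCLM (hu : IsBlockKernel u a M) (f : 𝓢(EuclideanSpace ℝ σ, ℂ)) (α : σ →₀ ℕ) :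
    hermiteCoeff α (hermiteBlockCLM u hu f) = blockCoeff u f α :=
  hermiteCoeff_hermiteBlockₗ u hu f α

variable {u}

/-- The uniform seminorm bound for `hermiteBlockCLM`. [folklore] -/
theorem exists_seminorm_hermiteBlockCLM_le_sup_seminorm (k l a : ℕ) :
    ∃ (s : Finset (ℕ × ℕ)) (C : ℝ), 0 ≤ C ∧
      ∀ (u : (σ →₀ ℕ) → (σ →₀ ℕ) → ℂ) (M : ℝ) (hu : IsBlockKernel u a M) (f : 𝓢(EuclideanSpace ℝ σ, ℂ)),
        SchwartzMap.seminorm ℂ k l (hermiteBlockCLM u hu f) ≤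
          M * C * (s.sup (schwartzSeminormFamily ℂ (EuclideanSpace ℝ σ) ℂ)) f :=
  exists_seminorm_hermiteBlockₗ_le_sup_seminorm k l a

/-- The block coefficient of a basis vector: `w_α(h_β) = u(α,β)` (it vanishes automatically off the block).
[folklore] -/
theorem blockCoeff_herm (hu : IsBlockKernel u a M) (α β : σ →₀ ℕ) :
    blockCoeff u (hermiteSchwartz (herm β)) α = u α β := by
  rw [blockCoeff]
  simp_rw [hermiteCoeff_herm, mul_ite, mul_one, mul_zero]
  rw [Finset.sum_ite_eq' (degLE α.degree) β]
  split_ifs with h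
  · rfl
  · rw [mem_degLE_iff_degree_le, not_le] at h
    exact (hu.eq_zero α β (by omega)).symm

/-- **`c_α(T_u h_β) = u(α,β)`**: the kernel is the matrix of `T_u` in the Hermite basis. [folklore] -/
theorem hermiteCoeff_hermiteBlockCLM_herm (hu : IsBlockKernel u a M) (α β : σ →₀ ℕ) :
    hermiteCoeff α (hermiteBlockCLM u hu (hermiteSchwartz (herm β))) = u α β := by
  rw [hermiteCoeff_hermiteBlockCLM, blockCoeff_herm hu]

/-- **Action on the basis**: `T_u h_β = Σ_{|α| ≤ |β|} u(α,β) h_α` (a finite sum inside the block of `β`).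
[folklore] -/
theorem hermiteBlockCLM_herm (hu : IsBlockKernel u a M) (β : σ →₀ ℕ) :
    hermiteBlockCLM u hu (hermiteSchwartz (herm β)) =
      ∑ α ∈ degLE β.degree, u α β • hermiteSchwartz (herm (σ := σ) α) := by
  refine ext_hermiteCoeff fun γ => ?_
  rw [hermiteCoeff_hermiteBlockCLM_herm hu, hermiteCoeff_sum_smul_herm]
  split_ifs with h
  · rfl
  · rw [mem_degLE_iff_degree_le, not_le] at h
    exact hu.eq_zero γ β (by omega)

/-- The diagonal kernel of a multiplier. [folklore] -/
def diagonalKernel (m : (σ →₀ ℕ) → ℂ) (α β : σ →₀ ℕ) : ℂ := if α = β then m α else 0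

omit [Fintype σ] in
/-- A multiplier of polynomial growth gives a diagonal block kernel. [folklore] -/
theorem isBlockKernel_diagonalKernel {m : (σ →₀ ℕ) → ℂ} {a : ℕ} {M : ℝ} (hm : IsPolyBounded m a M) :
    IsBlockKernel (diagonalKernel m) a M where
  eq_zero α β h := by
    rw [diagonalKernel, if_neg]
    rintro rfl
    exact h rfl
  norm_le α β := by
    unfold diagonalKernel
    split_ifs with h
    · subst h; exact hm α
    · rw [norm_zero]; exact mul_nonneg hm.nonneg (by positivity)

/-- **Consistency with the diagonal case**: the block operator of the diagonal kernel of `m` is the Hermite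
multiplier `T_m`. [folklore] -/
theorem hermiteBlockCLM_diagonal {m : (σ →₀ ℕ) → ℂ} {a : ℕ} {M : ℝ} (hm : IsPolyBounded m a M)
    (f : 𝓢(EuclideanSpace ℝ σ, ℂ)) :
    hermiteBlockCLM (diagonalKernel m) (isBlockKernel_diagonalKernel hm) f = hermiteMultiplierCLM m hm f := by
  refine ext_hermiteCoeff fun α => ?_
  rw [hermiteCoeff_hermiteBlockCLM, hermiteCoeff_hermiteMultiplierCLM, blockCoeff]
  simp_rw [diagonalKernel, ite_mul, zero_mul]
  rw [Finset.sum_ite_eq (degLE α.degree) α, if_pos (mem_degLE_iff_degree_le.2 le_rfl)]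

/-- **Difference of block operators**: `T_u f − T_{u′} f = T_{u−u′} f`. [folklore] -/
theorem hermiteBlockCLM_sub_apply (hu : IsBlockKernel u a M) (hu' : IsBlockKernel u' a M')
    (f : 𝓢(EuclideanSpace ℝ σ, ℂ)) :
    hermiteBlockCLM u hu f - hermiteBlockCLM u' hu' f = hermiteBlockCLM (u - u') (hu.sub hu') f := by
  refine ext_hermiteCoeff fun α => ?_
  rw [← hermiteCoeffCLM_apply, map_sub, hermiteCoeffCLM_apply, hermiteCoeffCLM_apply,
    hermiteCoeff_hermiteBlockCLM, hermiteCoeff_hermiteBlockCLM, hermiteCoeff_hermiteBlockCLM,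
    blockCoeff_sub_kernel]

/-- Seminorm bound for the difference of two block operators in terms of the weighted mass of `f`:
`p_{k,l}(T_u f − T_{u′} f) ≤ ‖u − u′‖-constant · C · (s.sup p)(f)`. [folklore] -/
theorem seminorm_hermiteBlockCLM_sub_le (hu : IsBlockKernel u a M) (hu' : IsBlockKernel u' a M') {k l : ℕ}
    {C : ℝ} (hC0 : 0 ≤ C)
    (hC : ∀ α : σ →₀ ℕ, SchwartzMap.seminorm ℂ k l (hermiteSchwartz (herm α)) ≤
      C * ((α.degree : ℝ) + 1) ^ (k + l + Fintype.card σ + 1))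
    (f : 𝓢(EuclideanSpace ℝ σ, ℂ)) :
    SchwartzMap.seminorm ℂ k l (hermiteBlockCLM u hu f - hermiteBlockCLM u' hu' f) ≤
      C * ∑' α : σ →₀ ℕ, ((α.degree : ℝ) + 1) ^ (k + l + Fintype.card σ + 1) *
        ‖blockCoeff (u - u') f α‖ := by
  rw [hermiteBlockCLM_sub_apply hu hu']
  exact seminorm_le_of_hasSum hC0 hC (hasSum_hermiteBlockCLM (u - u') (hu.sub hu') f)
    (summable_degree_pow_mul_norm_blockCoeff (hu.sub hu') _ f)

end Operator

/-! ## §3  Strong continuity of block families -/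

section StrongContinuity

variable {a : ℕ} {M : ℝ}
variable {ι : Type*} {l : Filter ι} {ui : ι → (σ →₀ ℕ) → (σ →₀ ℕ) → ℂ} {u₀ : (σ →₀ ℕ) → (σ →₀ ℕ) → ℂ}

/-- The weighted difference masses `Σ_α (|α|+1)^μ ‖w^{u_i − u₀}_α(f)‖` tend to `0` along a filter whenever the
kernels converge entrywise with a uniform block bound (Tannery's theorem; domination by
`2M Q_ν(f) (|α|+1)^{−(n+2)}`). [folklore] -/
theorem tendsto_tsum_degree_pow_mul_norm_blockCoeff_sub (hui : ∀ i, IsBlockKernel (ui i) a M)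
    (hu₀ : IsBlockKernel u₀ a M) (hc : ∀ α β : σ →₀ ℕ, Tendsto (fun i => ui i α β) l (𝓝 (u₀ α β)))
    (f : 𝓢(EuclideanSpace ℝ σ, ℂ)) (μ : ℕ) :
    Tendsto (fun i => ∑' α : σ →₀ ℕ, ((α.degree : ℝ) + 1) ^ μ * ‖blockCoeff (ui i - u₀) f α‖) l (𝓝 0) := by
  set n : ℕ := Fintype.card σ
  have hlim : Tendsto (fun i => ∑' α : σ →₀ ℕ, ((α.degree : ℝ) + 1) ^ μ * ‖blockCoeff (ui i - u₀) f α‖)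
      l (𝓝 (∑' α : σ →₀ ℕ, ((α.degree : ℝ) + 1) ^ μ * ‖blockCoeff (u₀ - u₀) f α‖)) := by
    refine tendsto_tsum_of_dominated_convergence
      (bound := fun α : σ →₀ ℕ => (M + M) * coeffMass (μ + a + n + (n + 2)) f *
        (((α.degree : ℝ) + 1) ^ (n + 2))⁻¹)
      ((summable_inv_degree_add_one_pow (σ := σ)).mul_left _) (fun α => ?_)
      (Eventually.of_forall fun i α => ?_)
    · refine (tendsto_const_nhds.mul (Tendsto.norm ?_))
      simp only [blockCoeff, Pi.sub_apply]
      exact tendsto_finsetSum _ fun β _ => ((hc α β).sub tendsto_const_nhds).mul tendsto_const_nhds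
    · rw [Real.norm_of_nonneg (by positivity)]
      exact degree_pow_mul_norm_blockCoeff_le ((hui i).sub hu₀) μ f α
  have h0 : ∀ α : σ →₀ ℕ, blockCoeff (u₀ - u₀) f α = 0 := fun α => by
    rw [blockCoeff_sub_kernel, sub_self]
  simpa only [h0, norm_zero, mul_zero, tsum_zero] using hlim

/-- **Convergence of block operators along a filter** (strong operator topology on `𝒮`): if
`u_i(α,β) → u₀(α,β)` for all `α, β` and all kernels are block kernels with the same exponent and constant, then
`T_{u_i} f → T_{u₀} f` in `𝒮(ℝ^σ, ℂ)` for every `f`. [folklore] -/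
theorem tendsto_hermiteBlockCLM_apply (hui : ∀ i, IsBlockKernel (ui i) a M) (hu₀ : IsBlockKernel u₀ a M)
    (hc : ∀ α β : σ →₀ ℕ, Tendsto (fun i => ui i α β) l (𝓝 (u₀ α β))) (f : 𝓢(EuclideanSpace ℝ σ, ℂ)) :
    Tendsto (fun i => hermiteBlockCLM (ui i) (hui i) f) l (𝓝 (hermiteBlockCLM u₀ hu₀ f)) := by
  have hW := schwartz_withSeminorms ℂ (EuclideanSpace ℝ σ) ℂ
  rw [hW.tendsto_nhds]
  rintro ⟨k, l'⟩ ε hε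
  obtain ⟨C, hC0, hC⟩ := exists_seminorm_hermiteSchwartz_herm_le (σ := σ) k l'
  have hlim := (tendsto_tsum_degree_pow_mul_norm_blockCoeff_sub hui hu₀ hc f
    (k + l' + Fintype.card σ + 1)).const_mul C
  rw [mul_zero] at hlim
  filter_upwards [hlim.eventually (Iio_mem_nhds hε)] with i hi
  exact (seminorm_hermiteBlockCLM_sub_le (hui i) hu₀ hC0 hC f).trans_lt hi

variable {T : Type*} [TopologicalSpace T] {ut : T → (σ →₀ ℕ) → (σ →₀ ℕ) → ℂ}

/-- **Strong continuity of block families**: if every entry `t ↦ u_t(α,β)` is continuous and the `u_t` are block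
kernels with a uniform exponent and constant, then `t ↦ T_{u_t} f` is continuous into `𝒮(ℝ^σ, ℂ)` for every
Schwartz `f`. [folklore] -/
theorem continuous_hermiteBlockCLM_apply (hut : ∀ t, IsBlockKernel (ut t) a M)
    (hc : ∀ α β : σ →₀ ℕ, Continuous fun t => ut t α β) (f : 𝓢(EuclideanSpace ℝ σ, ℂ)) :
    Continuous fun t => hermiteBlockCLM (ut t) (hut t) f :=
  continuous_iff_continuousAt.2 fun t₀ =>
    tendsto_hermiteBlockCLM_apply hut (hut t₀) (fun α β => (hc α β).tendsto t₀) f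

/-- **Joint continuity** `(t, f) ↦ T_{u_t} f` on `T × 𝒮(ℝ^σ, ℂ)` (equicontinuity in `f` from the uniform seminorm
bounds + strong continuity in `t`). [folklore] -/
theorem continuous_hermiteBlockCLM_uncurry (hut : ∀ t, IsBlockKernel (ut t) a M)
    (hc : ∀ α β : σ →₀ ℕ, Continuous fun t => ut t α β) :
    Continuous fun p : T × 𝓢(EuclideanSpace ℝ σ, ℂ) => hermiteBlockCLM (ut p.1) (hut p.1) p.2 := by
  have hW := schwartz_withSeminorms ℂ (EuclideanSpace ℝ σ) ℂ
  refine continuous_iff_continuousAt.2 fun ⟨t₀, f₀⟩ => ?_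
  rw [ContinuousAt, hW.tendsto_nhds]
  rintro ⟨k, l⟩ ε hε
  obtain ⟨s, C, hC0, hC⟩ := exists_seminorm_hermiteBlockCLM_le_sup_seminorm (σ := σ) k l a
  -- equicontinuity part: the seminorm `S = s.sup p` of `f - f₀` is small near `f₀`
  set S := s.sup (schwartzSeminormFamily ℂ (EuclideanSpace ℝ σ) ℂ) with hS
  have hM : 0 ≤ M := (hut t₀).nonneg
  have hSle : ∀ g, S g ≤ ∑ i ∈ s, schwartzSeminormFamily ℂ (EuclideanSpace ℝ σ) ℂ i g := fun g =>
    finset_sup_schwartzSeminormFamily_apply_le_sum s g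
  have hScont : Continuous fun g : 𝓢(EuclideanSpace ℝ σ, ℂ) =>
      ∑ i ∈ s, schwartzSeminormFamily ℂ (EuclideanSpace ℝ σ) ℂ i g :=
    continuous_finsetSum s fun i _ => hW.continuous_seminorm i
  have h1 : Tendsto (fun p : T × 𝓢(EuclideanSpace ℝ σ, ℂ) =>
      ∑ i ∈ s, schwartzSeminormFamily ℂ (EuclideanSpace ℝ σ) ℂ i (p.2 - f₀)) (𝓝 (t₀, f₀)) (𝓝 0) := by
    have hcont : Continuous fun p : T × 𝓢(EuclideanSpace ℝ σ, ℂ) =>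
        ∑ i ∈ s, schwartzSeminormFamily ℂ (EuclideanSpace ℝ σ) ℂ i (p.2 - f₀) :=
      hScont.comp (continuous_snd.sub continuous_const)
    have h := hcont.tendsto (t₀, f₀)
    simpa only [sub_self, map_zero, Finset.sum_const_zero] using h
  -- strong continuity part at `f₀`
  have h2 : Tendsto (fun p : T × 𝓢(EuclideanSpace ℝ σ, ℂ) =>
      hermiteBlockCLM (ut p.1) (hut p.1) f₀) (𝓝 (t₀, f₀)) (𝓝 (hermiteBlockCLM (ut t₀) (hut t₀) f₀)) :=
    (continuous_hermiteBlockCLM_apply hut hc f₀).continuousAt.tendsto.comp (continuous_fst.tendsto (t₀, f₀))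
  rw [hW.tendsto_nhds] at h2
  have h2' := h2 (k, l) (ε / 2) (half_pos hε)
  have hε' : 0 < ε / 2 / (M * C + 1) := div_pos (half_pos hε) (by positivity)
  filter_upwards [h1.eventually (Iio_mem_nhds hε'), h2'] with p hp1 hp2
  have e1 : SchwartzMap.seminorm ℂ k l
      (hermiteBlockCLM (ut p.1) (hut p.1) p.2 - hermiteBlockCLM (ut p.1) (hut p.1) f₀) < ε / 2 := by
    rw [← map_sub]
    refine (hC (ut p.1) M (hut p.1) (p.2 - f₀)).trans_lt ?_
    have h3 : S (p.2 - f₀) < ε / 2 / (M * C + 1) := (hSle _).trans_lt hp1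
    calc M * C * S (p.2 - f₀) ≤ (M * C + 1) * S (p.2 - f₀) := by
          refine mul_le_mul_of_nonneg_right (by linarith) (apply_nonneg _ _)
      _ < (M * C + 1) * (ε / 2 / (M * C + 1)) := by gcongr
      _ = ε / 2 := by field_simp
  have e2 : SchwartzMap.seminorm ℂ k l
      (hermiteBlockCLM (ut p.1) (hut p.1) f₀ - hermiteBlockCLM (ut t₀) (hut t₀) f₀) < ε / 2 := hp2
  calc schwartzSeminormFamily ℂ (EuclideanSpace ℝ σ) ℂ (k, l)
        (hermiteBlockCLM (ut p.1) (hut p.1) p.2 - hermiteBlockCLM (ut t₀) (hut t₀) f₀)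
      = SchwartzMap.seminorm ℂ k l
          ((hermiteBlockCLM (ut p.1) (hut p.1) p.2 - hermiteBlockCLM (ut p.1) (hut p.1) f₀) +
            (hermiteBlockCLM (ut p.1) (hut p.1) f₀ - hermiteBlockCLM (ut t₀) (hut t₀) f₀)) := by
        rw [sub_add_sub_cancel]; rfl
    _ ≤ SchwartzMap.seminorm ℂ k l
          (hermiteBlockCLM (ut p.1) (hut p.1) p.2 - hermiteBlockCLM (ut p.1) (hut p.1) f₀) +
          SchwartzMap.seminorm ℂ k l
          (hermiteBlockCLM (ut p.1) (hut p.1) f₀ - hermiteBlockCLM (ut t₀) (hut t₀) f₀) := map_add_le_add _ _ _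
    _ < ε / 2 + ε / 2 := add_lt_add e1 e2
    _ = ε := add_halves ε

end StrongContinuity

end Literature.Analysis.SegalBargmann

end
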